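import Literature.NumberTheory.IwasawaTheory.ClassicalMuVanishesBiquadraticTwo
import Mathlib.RingTheory.Localization.Integral
import HarnessLib

/-!
# `μ₂ = 0` for every QUARTIC number field with a quadratic subfield `ℚ(√a)` and no ramified real place above it — `a < 0`, or the quartic
# totally real — and not containing `√2`: e.g. every quartic field containing an imaginary quadratic field (Galois or NOT), and every
# totally real quartic with a real quadratic subfield (proved; no definition, no named fact)

`Proofs`-style file (theorems only) in topic `NumberTheory/IwasawaTheory` (namespace `Literature.NumberTheory.IwasawaTheory`), written by the prover
seat `bsd-line-att-p3` g34 (cell `bsd-f1-sign2`; `--supports` stmt-BirchSwinnertonDyer-22298; closes nothing). Generalises this seat's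
`classicalMuVanishes_of_biquadratic` (the `V₄` case) to ALL quartic fields `K' ⊇ ℚ(x)`, `x² = a ∈ ℚ ∖ ℚ²`: `K'/ℚ(x)` is quadratic, generated by an integral
`y` with `y² ∈ 𝓞_{ℚ(x)}` (square-root generator + an integral multiple), and in the two signature-free situations — `a < 0` (base totally complex:
Iwasawa 1973 Thm. 3 verbatim) or `K'` totally real (nothing ramifies at infinity: Iwasawa 1973 Thm. 2, proof pp. 7–8) — this seat's intrinsic ascents
apply on top of `μ₂(ℚ(x)) = 0` (`classicalMuVanishes_of_finrank_eq_two`). NOT an instance of Ferrero–Washington when `K'/ℚ` is not abelian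
(e.g. `D₄`- or `C₄`-quartics `ℚ(√(u + v√a))`): it is Iwasawa 1973 + genus theory, fact-free in the tree.

* ★★ `classicalMuVanishes_of_finrank_eq_four_of_sq_eq_of_neg` — `[K' : ℚ] = 4`, `x ∈ K'`, `x² = a < 0` (`a ∈ ℚ`), `√2 ∉ K'` ⟹ `μ₂ = 0` for every cyclotomic
  `ℤ₂`-extension of `K'` (ANY quartic field containing an imaginary quadratic subfield).
* ★★ `classicalMuVanishes_of_finrank_eq_four_of_sq_eq_of_isTotallyReal` — `K'` totally real quartic, `x² = a ∈ ℚ ∖ ℚ²`, `√2 ∉ K'` ⟹ the same.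

References: [Iwasawa1973MuInvariants] Thm. 2 and its proof, Thm. 3, §4; [Washington1997] §13.3 Prop. 13.23; [FerreroWashington1979] (the abelian sub-case);
[Greenberg1976TotallyReal] §1.
-/

set_option autoImplicit false

noncomputable section

open scoped NumberField Classical
open NumberField Field IntermediateField IsDedekindDomain Polynomial

namespace Literature.NumberTheory.IwasawaTheory

open Literature.NumberTheory.EllipticCurves Literature.NumberTheory.EllipticCurves.ZpExtension
  Literature.NumberTheory.GaloisRepresentations Literature.NumberTheory.NumberFields
  Literature.NumberTheory.QuadraticFields

variable {K' : Type} [Field K'] [NumberField K']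

/-- `x ∉ ℚ` when `x² = a` with `a ∉ ℚ²`. [folklore] -/
private theorem not_mem_range_of_sq_eq' {x : K'} {a : ℚ} (hx : x ^ 2 = (a : K')) (ha : ¬ IsSquare a) :
    x ∉ Set.range (algebraMap ℚ K') := by
  rintro ⟨q, hq⟩
  apply ha
  refine ⟨q, ?_⟩
  have h : (algebraMap ℚ K') (q * q) = algebraMap ℚ K' a := by
    rw [map_mul, hq, ← sq, hx, eq_ratCast]
  exact ((algebraMap ℚ K').injective h).symm

/-- The common core: `K'` quartic over `ℚ` containing `x` with `x² = a ∉ ℚ²`, `√2 ∉ K'`, and EITHER `ℚ(x)` totally complex OR `K'` totally real ⟹ `μ₂(K') = 0`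
for every cyclotomic `ℤ₂`-extension: `K' = ℚ(x)(y)` with `y` integral, `y² ∈ 𝓞_{ℚ(x)}`, then one of the two signature-free ascents over
`μ₂(ℚ(x)) = 0`. [cite: Iwasawa1973MuInvariants, Thm. 2 and Thm. 3 (and proofs, pp. 7–8)] [cite: Washington1997, §13.3 Prop. 13.23] -/
private theorem classicalMu_of_quartic_core {x : K'} {a : ℚ} (hx : x ^ 2 = (a : K')) (ha : ¬ IsSquare a)
    (h4 : Module.finrank ℚ K' = 4) (h2 : ∀ z : K', z ^ 2 ≠ 2) (hsig : IsTotallyComplex ↥ℚ⟮x⟯ ∨ IsTotallyReal K') :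
    ∀ κ' : ZpExtension K' 2, κ'.IsCyclotomic → ClassicalMuVanishes κ' := by
  haveI : Fact (Nat.Prime 2) := ⟨Nat.prime_two⟩
  set F : IntermediateField ℚ K' := ℚ⟮x⟯ with hFdef
  have hxint : IsIntegral ℚ x := IsIntegral.of_finite ℚ x
  haveI : FiniteDimensional ℚ ↥F := IntermediateField.adjoin.finiteDimensional hxint
  haveI : NumberField ↥F := NumberField.of_module_finite ℚ _
  have hxQ := not_mem_range_of_sq_eq' hx ha
  have hF2 : Module.finrank ℚ ↥F = 2 := finrank_adjoin_simple_eq_two_of_sq_eq (by rw [hx, eq_ratCast]) hxQ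
  have hK'F : Module.finrank ↥F K' = 2 := by
    have htower : Module.finrank ℚ ↥F * Module.finrank ↥F K' = Module.finrank ℚ K' := Module.finrank_mul_finrank ℚ ↥F K'
    rw [hF2, h4] at htower
    omega
  have hμF : ∀ κP : ZpExtension ↥F 2, κP.IsCyclotomic → ClassicalMuVanishes κP :=
    fun κP hκP ↦ classicalMuVanishes_of_finrank_eq_two ↥F hF2 κP hκP
  -- a square-root generator `θ` of `K'/F` and an integral multiple `y = n θ`
  obtain ⟨θ, c, hθF, hθc⟩ := Quadratic.exists_sq_eq_algebraMap (F := ↥F) (K := K') hK'F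
  have halg : IsAlgebraic ℤ θ := (IsFractionRing.isAlgebraic_iff ℤ ℚ K').mpr (Algebra.IsAlgebraic.isAlgebraic θ)
  obtain ⟨n, hn0, hnint⟩ := halg.exists_integral_multiple
  set y : 𝓞 K' := ⟨n • θ, hnint⟩ with hydef
  have hyval : ((y : 𝓞 K') : K') = (n : K') * θ := by rw [hydef]; simp [zsmul_eq_mul]
  -- `y² = n²·c ∈ F`, an algebraic integer of `F`
  have hysq : ((y : 𝓞 K') : K') ^ 2 = algebraMap ↥F K' ((n : ↥F) ^ 2 * c) := by
    rw [hyval, mul_pow, hθc, map_mul, map_pow, map_intCast]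
  have hmint : IsIntegral ℤ ((n : ↥F) ^ 2 * c) := by
    have h1 : IsIntegral ℤ (((y : 𝓞 K') : K') ^ 2) := y.isIntegral_coe.pow 2
    rw [hysq] at h1
    exact (isIntegral_algHom_iff (IsScalarTower.toAlgHom ℤ ↥F K') (algebraMap ↥F K').injective).mp h1
  set m : 𝓞 ↥F := ⟨(n : ↥F) ^ 2 * c, hmint⟩ with hmdef
  have hc0 : c ≠ 0 := by
    intro h0
    apply hθF
    refine ⟨0, ?_⟩
    have : θ ^ 2 = 0 := by rw [hθc, h0, map_zero]
    rw [map_zero]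
    exact ((pow_eq_zero_iff two_ne_zero).mp this).symm
  have hm : m ≠ 0 := by
    intro h0
    have : (n : ↥F) ^ 2 * c = 0 := by
      have := congrArg (fun t : 𝓞 ↥F ↦ (t : ↥F)) h0
      simpa [hmdef] using this
    rcases mul_eq_zero.mp this with h | h
    · exact hn0 (by exact_mod_cast (pow_eq_zero_iff two_ne_zero).mp h)
    · exact hc0 h
  have hy2 : y ^ 2 = algebraMap (𝓞 ↥F) (𝓞 K') m := by
    apply RingOfIntegers.ext
    change ((y : 𝓞 K') : K') ^ 2 = algebraMap ↥F K' ((m : 𝓞 ↥F) : ↥F)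
    rw [hysq]
    rfl
  -- `K' = F[y]`
  have hyF : ((y : 𝓞 K') : K') ∉ Set.range (algebraMap ↥F K') := by
    rintro ⟨t, ht⟩
    apply hθF
    refine ⟨(n : ↥F)⁻¹ * t, ?_⟩
    have hn0' : (n : K') ≠ 0 := by exact_mod_cast hn0
    rw [map_mul, map_inv₀, map_intCast, ht, hyval]
    field_simp
  have hgen : Algebra.adjoin ↥F {((y : 𝓞 K') : K')} = ⊤ := by
    have hy'int : IsIntegral ↥F ((y : 𝓞 K') : K') := IsIntegral.of_finite _ _
    have hdeg2 : Module.finrank ↥F ↥(↥F)⟮((y : 𝓞 K') : K')⟯ = 2 :=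
      finrank_adjoin_simple_eq_two_of_sq_eq (a := (n : ↥F) ^ 2 * c) hysq hyF
    have htop : (↥F)⟮((y : 𝓞 K') : K')⟯ = ⊤ :=
      IntermediateField.eq_of_le_of_finrank_eq le_top (by rw [hdeg2, IntermediateField.finrank_top', hK'F])
    rw [← IntermediateField.adjoin_simple_toSubalgebra_of_isAlgebraic hy'int.isAlgebraic, htop, IntermediateField.top_toSubalgebra]
  -- the two signature-free ascents
  intro κ' hκ'
  rcases hsig with hC | hR
  · haveI := hC
    exact classicalMu_of_sq_eq_of_isTotallyComplex ↥F K' hK'F hm hy2 hgen h2 hμF κ' hκ'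
  · haveI := hR
    exact classicalMu_of_sq_eq_of_isTotallyReal ↥F K' hK'F hm hy2 hgen h2 hμF κ' hκ'

/-- ★★ **`μ₂ = 0` for EVERY quartic number field containing an imaginary quadratic subfield** (and not containing `√2`): `[K' : ℚ] = 4`, `x ∈ K'` with
`x² = a < 0` rational, `√2 ∉ K'` ⟹ every cyclotomic `ℤ₂`-extension of `K'` has `μ = 0` (growth form). `K'` is a quadratic extension of the totally complex
`ℚ(x)` (`μ₂ = 0` by genus theory): Iwasawa 1973 Thm. 3 verbatim, kernel. Covers non-abelian quartics (`D₄`, `C₄` closures), where Ferrero–Washington does not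
apply. [cite: Iwasawa1973MuInvariants, Thm. 3 and §4] [cite: Washington1997, §13.3 Prop. 13.23] -/
theorem classicalMuVanishes_of_finrank_eq_four_of_sq_eq_of_neg {x : K'} {a : ℚ} (hx : x ^ 2 = (a : K')) (ha0 : a < 0)
    (h4 : Module.finrank ℚ K' = 4) (h2 : ∀ z : K', z ^ 2 ≠ 2) (κ' : ZpExtension K' 2) (hκ' : κ'.IsCyclotomic) :
    ClassicalMuVanishes κ' :=
  have ha : ¬ IsSquare a := fun ⟨r, hr⟩ ↦ by nlinarith [mul_self_nonneg r]
  classicalMu_of_quartic_core hx ha h4 h2 (Or.inl (isTotallyComplex_adjoin_of_sq_eq_of_neg hx ha0)) κ' hκ'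

/-- ★★ **`μ₂ = 0` for EVERY totally real quartic number field with a quadratic subfield** (and not containing `√2`): `K'` totally real, `[K' : ℚ] = 4`,
`x ∈ K'` with `x² = a ∈ ℚ ∖ ℚ²`, `√2 ∉ K'` ⟹ every cyclotomic `ℤ₂`-extension of `K'` has `μ = 0`. `K'/ℚ(x)` quadratic with nothing ramified at
infinity along the (totally real) layers: Iwasawa 1973 Thm. 2, proof pp. 7–8; `μ₂(ℚ(x)) = 0` by genus theory. Covers non-abelian totally real quartics.
[cite: Iwasawa1973MuInvariants, Thm. 2 and its proof] [cite: Greenberg1976TotallyReal, §1] [cite: Washington1997, §13.3 Prop. 13.23] -/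
theorem classicalMuVanishes_of_finrank_eq_four_of_sq_eq_of_isTotallyReal [IsTotallyReal K'] {x : K'} {a : ℚ} (hx : x ^ 2 = (a : K'))
    (ha : ¬ IsSquare a) (h4 : Module.finrank ℚ K' = 4) (h2 : ∀ z : K', z ^ 2 ≠ 2) (κ' : ZpExtension K' 2) (hκ' : κ'.IsCyclotomic) :
    ClassicalMuVanishes κ' :=
  classicalMu_of_quartic_core hx ha h4 h2 (Or.inr ‹IsTotallyReal K'›) κ' hκ'

end Literature.NumberTheory.IwasawaTheory

end
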